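import Summits.BirchSwinnertonDyer.BirchSwinnertonDyer.Theorems.KatoDescentPotSupersingularWildUpperUnitTwistRecordsSharpImg13
import Summits.BirchSwinnertonDyer.BirchSwinnertonDyer.Theorems.KatoDescentTamePotSupersingularJetchevIrreducibleReadingTwoSplit
import HarnessLib

/-!
# Route `KatoDescentPotSupersingular` (rung K9, sub-rung B5 = O6 wild `p = 3`, cell `bsd-potss`): NAMED-FACTS FORM of the ♯ unit-twist records
# — the displayed SCHEMA `hJ2` REPLACED by the four named Literature facts BY NAME (the held aliases 23034–23037 of the K9 route) +
# Kolyvagin + newforms, on top of the Tamagawa and mod-3-image kernel upgrades (part 10: 228150s1@3, 261360hb1@3, 280800s1@3, 365040ig1@3, 412992bx1@3, 447174gp1@3)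
# (seat `bsd-potss-k9-c4` g17; `--supports stmt-BirchSwinnertonDyer-19197 --as helper`)

HONEST FRAMING. THEOREMS ONLY (no definition, no named fact, no `sorry`); PER PAIR; nothing booked; items 19189 / 19197 / 21422 stay OPEN
class-wide; BSD is not proved for any class.  The ♯ records (and their `_tam` / `_img` upgrades, this seat) display the reading schema
`hJ2`; k9-c4 g11 PROVED that schema from four named Literature facts — Matar–Nekovář 2019 Thm 0.7 (`hS1`), Gross 1991 Prop 3.7 (2) (`h37`),
Poitou–Tate for Selmer structures (`hPT`), Gross–Zagier III (3.1) image-free (`hF1`) — plus Kolyvagin (`hKo`) and modularity as newforms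
(`hnf`): `JetchevIrreducibleSwapAtP.cor15_irreducibleReadingTwoSplit_of_namedFacts`.  This file substitutes that proof per row (exactly as k8t-c4 g14's p598182 does for the KT ♯ records): `missingUpperBoundAt_g<label>_3_nf` =
the upgraded record (`_img` on Cartan rows, `_tam` on 9-deficient rows) with `hJ2` DERIVED.  After this, a ♯ record's displayed hypotheses are:
the named facts BY NAME (`hGZ hKo hMN hGZK hmod hS1 h37 hPT hF1 hnf` — published / cite-level HELD items), Cremona's `N`, `r_an = 0`, the
lattice-optimal datum with `3 ∤ c(D)`, the field, the twist numerics (+ `hns` on 9-deficient rows) — no schema, no Tamagawa datum, no image datum.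
Import note: the derivation's module has the K9 (and KT) route file in its import cone, as p598182's does; the theorem used takes no route
declaration as a hypothesis.

References: [Jetchev2008] Conj. 1.3, Thm. 1.4, Cor. 1.5, Rem. 6.2; [MatarNekovar2019] Thm. 0.7, §0.11; [GrossLMS1991] Prop. 3.7 (2); [GrossZagier1986]
I.6.3, III (3.1); [MilneADT2006] I Thm. 4.10; [KolyvaginEulerSystems1990] Thm. A; [Miller2011LMS] Def. 1.1; [Cremona2006] Table 1.
-/

set_option autoImplicit false
set_option linter.dupNamespace false
noncomputable section
open scoped Classical NumberField
open WeierstrassCurve NumberField Field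
  Literature.NumberTheory.EllipticCurves
  Literature.NumberTheory.EllipticCurves.ModularForms Literature.NumberTheory.EllipticCurves.Rank1Residual
  Literature.NumberTheory.EllipticCurves.Rank1Residual.Typed Literature.NumberTheory.Automorphic
  Literature.NumberTheory.GaloisCohomology
  Summit.BirchSwinnertonDyer.Rank1Residual Summit.BirchSwinnertonDyer.Rank1Residual.Additive
  Summit.BirchSwinnertonDyer.BirchSwinnertonDyer.Theorems

namespace Summit.BirchSwinnertonDyer.BirchSwinnertonDyer.Theorems.WildUpperUnitTwistRecords

/-- **RECORD `228150s1` @ `3`, NAMED-FACTS FORM** — `missingUpperBoundAt_g228150s1_3_img` with the schema `hJ2` DERIVED from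
`hS1 h37 hPT hF1 hKo hnf` (`JetchevIrreducibleSwapAtP.cor15_irreducibleReadingTwoSplit_of_namedFacts`). Displayed: named facts by name, Cremona's `N`, `r_an = 0`,
the lattice-optimal datum with `3 ∤ c(D)`, the field, the twist numerics. Per pair; nothing booked; BSD is not proved by this.
[cite: MatarNekovar2019, Thm. 0.7 (p. 456), §0.11 (p. 457)] [cite: GrossLMS1991, Prop. 3.7 (2)] [cite: GrossZagier1986, III (3.1)]
[cite: MilneADT2006, I Thm. 4.10] [cite: Jetchev2008, Cor. 1.5] [cite: Miller2011LMS, Def. 1.1] [cite: Cremona2006, Table 1 (Cremona label 228150s1)] -/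
theorem missingUpperBoundAt_g228150s1_3_nf
    (hGZ : ∀ (N : ℕ) [NeZero N] (W : WeierstrassCurve ℚ) (K : Type) [Field K] [NumberField K],
      gross_zagier N W K)
    (hKo : ∀ (N : ℕ) [NeZero N] (W : WeierstrassCurve ℚ) (K : Type) [Field K] [NumberField K],
      kolyvagin N W K)
    (hMN : ∀ (N : ℕ) [NeZero N] (W : WeierstrassCurve ℚ) (K : Type) [Field K] [NumberField K],
      MatarNekovar2019.thm03_padicValNat_card_sha_le_of_irreducible N W K)
    (hGZK : rank_eq_analyticRank_of_analyticRank_le_one) (hmod : hasEntireLFunction_rat)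
    (hS1 : MatarNekovar2019.thm07_padicValNat_card_sha_primary_add_le_of_globalDivisibility_of_irreducible)
    (h37 : GrossLMS1991.prop37_2_frobeniusCongruence)
    (hPT : ∀ (K : Type) [Field K] [NumberField K], poitouTate_selmerStructure_duality_conj K)
    (hF1 : Gross1991_heegnerPoint_sub_ratTorsion_mem_E0_imageFree) (hnf : exists_isNewformOf)
    {W : WeierstrassCurve ℚ} [W.IsElliptic] [W.IsGloballyMinimal] (hWeq : W = (⟨1, (-1), 1, (-24685355), 47199542147⟩ : WeierstrassCurve ℚ))
    (hN : W.conductorNorm ℤ = 228150) (hr : W.analyticRank = 0)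
    (D : ModularParametrizationData W 228150) (hopt : ∀ z ∈ D.L.lattice, ∃ w ∈ periodLattice D.f, z = (D.c : ℂ) * w)
    (hc : ¬ (3 : ℤ) ∣ D.c)
    (K : Type) [Field K] [NumberField K] (hK : IsImaginaryQuadratic K) (hdK : NumberField.discr K = -1511)
    {Wd : WeierstrassCurve ℚ} [Wd.IsElliptic] [Wd.IsGloballyMinimal] (hWdeq : Wd = (⟨1, (-1), 1, (-56359651679480), (-162807479776410897853)⟩ : WeierstrassCurve ℚ))
    (hrd : Wd.analyticRank = 1) {qd : ℚ} (hqd : shaAn Wd = (qd : ℂ)) (hvd : padicValRat 3 qd ≤ 0) :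
    MissingUpperBoundAt W 3 :=
  missingUpperBoundAt_g228150s1_3_img hGZ hKo hMN hGZK hmod (JetchevIrreducibleSwapAtP.cor15_irreducibleReadingTwoSplit_of_namedFacts hS1 h37 hPT hF1 hKo hnf) hWeq hN hr D hopt hc K hK hdK hWdeq hrd hqd hvd

/-- **RECORD `261360hb1` @ `3`, NAMED-FACTS FORM** — `missingUpperBoundAt_g261360hb1_3_img` with the schema `hJ2` DERIVED from
`hS1 h37 hPT hF1 hKo hnf` (`JetchevIrreducibleSwapAtP.cor15_irreducibleReadingTwoSplit_of_namedFacts`). Displayed: named facts by name, Cremona's `N`, `r_an = 0`,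
the lattice-optimal datum with `3 ∤ c(D)`, the field, the twist numerics. Per pair; nothing booked; BSD is not proved by this.
[cite: MatarNekovar2019, Thm. 0.7 (p. 456), §0.11 (p. 457)] [cite: GrossLMS1991, Prop. 3.7 (2)] [cite: GrossZagier1986, III (3.1)]
[cite: MilneADT2006, I Thm. 4.10] [cite: Jetchev2008, Cor. 1.5] [cite: Miller2011LMS, Def. 1.1] [cite: Cremona2006, Table 1 (Cremona label 261360hb1)] -/
theorem missingUpperBoundAt_g261360hb1_3_nf
    (hGZ : ∀ (N : ℕ) [NeZero N] (W : WeierstrassCurve ℚ) (K : Type) [Field K] [NumberField K],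
      gross_zagier N W K)
    (hKo : ∀ (N : ℕ) [NeZero N] (W : WeierstrassCurve ℚ) (K : Type) [Field K] [NumberField K],
      kolyvagin N W K)
    (hMN : ∀ (N : ℕ) [NeZero N] (W : WeierstrassCurve ℚ) (K : Type) [Field K] [NumberField K],
      MatarNekovar2019.thm03_padicValNat_card_sha_le_of_irreducible N W K)
    (hGZK : rank_eq_analyticRank_of_analyticRank_le_one) (hmod : hasEntireLFunction_rat)
    (hS1 : MatarNekovar2019.thm07_padicValNat_card_sha_primary_add_le_of_globalDivisibility_of_irreducible)
    (h37 : GrossLMS1991.prop37_2_frobeniusCongruence)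
    (hPT : ∀ (K : Type) [Field K] [NumberField K], poitouTate_selmerStructure_duality_conj K)
    (hF1 : Gross1991_heegnerPoint_sub_ratTorsion_mem_E0_imageFree) (hnf : exists_isNewformOf)
    {W : WeierstrassCurve ℚ} [W.IsElliptic] [W.IsGloballyMinimal] (hWeq : W = (⟨0, 0, 0, (-202121667), 1108212223426⟩ : WeierstrassCurve ℚ))
    (hN : W.conductorNorm ℤ = 261360) (hr : W.analyticRank = 0)
    (D : ModularParametrizationData W 261360) (hopt : ∀ z ∈ D.L.lattice, ∃ w ∈ periodLattice D.f, z = (D.c : ℂ) * w)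
    (hc : ¬ (3 : ℤ) ∣ D.c)
    (K : Type) [Field K] [NumberField K] (hK : IsImaginaryQuadratic K) (hdK : NumberField.discr K = -1319)
    {Wd : WeierstrassCurve ℚ} [Wd.IsElliptic] [Wd.IsGloballyMinimal] (hWdeq : Wd = (⟨0, 0, 0, (-351643393501587), (-2543064191566550524334)⟩ : WeierstrassCurve ℚ))
    (hrd : Wd.analyticRank = 1) {qd : ℚ} (hqd : shaAn Wd = (qd : ℂ)) (hvd : padicValRat 3 qd ≤ 0) :
    MissingUpperBoundAt W 3 :=
  missingUpperBoundAt_g261360hb1_3_img hGZ hKo hMN hGZK hmod (JetchevIrreducibleSwapAtP.cor15_irreducibleReadingTwoSplit_of_namedFacts hS1 h37 hPT hF1 hKo hnf) hWeq hN hr D hopt hc K hK hdK hWdeq hrd hqd hvd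

/-- **RECORD `280800s1` @ `3`, NAMED-FACTS FORM** — `missingUpperBoundAt_g280800s1_3_img` with the schema `hJ2` DERIVED from
`hS1 h37 hPT hF1 hKo hnf` (`JetchevIrreducibleSwapAtP.cor15_irreducibleReadingTwoSplit_of_namedFacts`). Displayed: named facts by name, Cremona's `N`, `r_an = 0`,
the lattice-optimal datum with `3 ∤ c(D)`, the field, the twist numerics. Per pair; nothing booked; BSD is not proved by this.
[cite: MatarNekovar2019, Thm. 0.7 (p. 456), §0.11 (p. 457)] [cite: GrossLMS1991, Prop. 3.7 (2)] [cite: GrossZagier1986, III (3.1)]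
[cite: MilneADT2006, I Thm. 4.10] [cite: Jetchev2008, Cor. 1.5] [cite: Miller2011LMS, Def. 1.1] [cite: Cremona2006, Table 1 (Cremona label 280800s1)] -/
theorem missingUpperBoundAt_g280800s1_3_nf
    (hGZ : ∀ (N : ℕ) [NeZero N] (W : WeierstrassCurve ℚ) (K : Type) [Field K] [NumberField K],
      gross_zagier N W K)
    (hKo : ∀ (N : ℕ) [NeZero N] (W : WeierstrassCurve ℚ) (K : Type) [Field K] [NumberField K],
      kolyvagin N W K)
    (hMN : ∀ (N : ℕ) [NeZero N] (W : WeierstrassCurve ℚ) (K : Type) [Field K] [NumberField K],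
      MatarNekovar2019.thm03_padicValNat_card_sha_le_of_irreducible N W K)
    (hGZK : rank_eq_analyticRank_of_analyticRank_le_one) (hmod : hasEntireLFunction_rat)
    (hS1 : MatarNekovar2019.thm07_padicValNat_card_sha_primary_add_le_of_globalDivisibility_of_irreducible)
    (h37 : GrossLMS1991.prop37_2_frobeniusCongruence)
    (hPT : ∀ (K : Type) [Field K] [NumberField K], poitouTate_selmerStructure_duality_conj K)
    (hF1 : Gross1991_heegnerPoint_sub_ratTorsion_mem_E0_imageFree) (hnf : exists_isNewformOf)
    {W : WeierstrassCurve ℚ} [W.IsElliptic] [W.IsGloballyMinimal] (hWeq : W = (⟨0, 0, 0, 37125, (-9618750)⟩ : WeierstrassCurve ℚ))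
    (hN : W.conductorNorm ℤ = 280800) (hr : W.analyticRank = 0)
    (D : ModularParametrizationData W 280800) (hopt : ∀ z ∈ D.L.lattice, ∃ w ∈ periodLattice D.f, z = (D.c : ℂ) * w)
    (hc : ¬ (3 : ℤ) ∣ D.c)
    (K : Type) [Field K] [NumberField K] (hK : IsImaginaryQuadratic K) (hdK : NumberField.discr K = -9671)
    {Wd : WeierstrassCurve ℚ} [Wd.IsElliptic] [Wd.IsGloballyMinimal] (hWdeq : Wd = (⟨0, 0, 0, 3472235947125, 8700271132476431250⟩ : WeierstrassCurve ℚ))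
    (hrd : Wd.analyticRank = 1) {qd : ℚ} (hqd : shaAn Wd = (qd : ℂ)) (hvd : padicValRat 3 qd ≤ 0) :
    MissingUpperBoundAt W 3 :=
  missingUpperBoundAt_g280800s1_3_img hGZ hKo hMN hGZK hmod (JetchevIrreducibleSwapAtP.cor15_irreducibleReadingTwoSplit_of_namedFacts hS1 h37 hPT hF1 hKo hnf) hWeq hN hr D hopt hc K hK hdK hWdeq hrd hqd hvd

/-- **RECORD `365040ig1` @ `3`, NAMED-FACTS FORM** — `missingUpperBoundAt_g365040ig1_3_img` with the schema `hJ2` DERIVED from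
`hS1 h37 hPT hF1 hKo hnf` (`JetchevIrreducibleSwapAtP.cor15_irreducibleReadingTwoSplit_of_namedFacts`). Displayed: named facts by name, Cremona's `N`, `r_an = 0`,
the lattice-optimal datum with `3 ∤ c(D)`, the field, the twist numerics. Per pair; nothing booked; BSD is not proved by this.
[cite: MatarNekovar2019, Thm. 0.7 (p. 456), §0.11 (p. 457)] [cite: GrossLMS1991, Prop. 3.7 (2)] [cite: GrossZagier1986, III (3.1)]
[cite: MilneADT2006, I Thm. 4.10] [cite: Jetchev2008, Cor. 1.5] [cite: Miller2011LMS, Def. 1.1] [cite: Cremona2006, Table 1 (Cremona label 365040ig1)] -/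
theorem missingUpperBoundAt_g365040ig1_3_nf
    (hGZ : ∀ (N : ℕ) [NeZero N] (W : WeierstrassCurve ℚ) (K : Type) [Field K] [NumberField K],
      gross_zagier N W K)
    (hKo : ∀ (N : ℕ) [NeZero N] (W : WeierstrassCurve ℚ) (K : Type) [Field K] [NumberField K],
      kolyvagin N W K)
    (hMN : ∀ (N : ℕ) [NeZero N] (W : WeierstrassCurve ℚ) (K : Type) [Field K] [NumberField K],
      MatarNekovar2019.thm03_padicValNat_card_sha_le_of_irreducible N W K)
    (hGZK : rank_eq_analyticRank_of_analyticRank_le_one) (hmod : hasEntireLFunction_rat)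
    (hS1 : MatarNekovar2019.thm07_padicValNat_card_sha_primary_add_le_of_globalDivisibility_of_irreducible)
    (h37 : GrossLMS1991.prop37_2_frobeniusCongruence)
    (hPT : ∀ (K : Type) [Field K] [NumberField K], poitouTate_selmerStructure_duality_conj K)
    (hF1 : Gross1991_heegnerPoint_sub_ratTorsion_mem_E0_imageFree) (hnf : exists_isNewformOf)
    {W : WeierstrassCurve ℚ} [W.IsElliptic] [W.IsGloballyMinimal] (hWeq : W = (⟨0, 0, 0, (-43217187), 109359897634⟩ : WeierstrassCurve ℚ))
    (hN : W.conductorNorm ℤ = 365040) (hr : W.analyticRank = 0)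
    (D : ModularParametrizationData W 365040) (hopt : ∀ z ∈ D.L.lattice, ∃ w ∈ periodLattice D.f, z = (D.c : ℂ) * w)
    (hc : ¬ (3 : ℤ) ∣ D.c)
    (K : Type) [Field K] [NumberField K] (hK : IsImaginaryQuadratic K) (hdK : NumberField.discr K = -7199)
    {Wd : WeierstrassCurve ℚ} [Wd.IsElliptic] [Wd.IsGloballyMinimal] (hWdeq : Wd = (⟨0, 0, 0, (-2239756689804387), (-40801357782879621316766)⟩ : WeierstrassCurve ℚ))
    (hrd : Wd.analyticRank = 1) {qd : ℚ} (hqd : shaAn Wd = (qd : ℂ)) (hvd : padicValRat 3 qd ≤ 0) :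
    MissingUpperBoundAt W 3 :=
  missingUpperBoundAt_g365040ig1_3_img hGZ hKo hMN hGZK hmod (JetchevIrreducibleSwapAtP.cor15_irreducibleReadingTwoSplit_of_namedFacts hS1 h37 hPT hF1 hKo hnf) hWeq hN hr D hopt hc K hK hdK hWdeq hrd hqd hvd

/-- **RECORD `412992bx1` @ `3`, NAMED-FACTS FORM** — `missingUpperBoundAt_g412992bx1_3_img` with the schema `hJ2` DERIVED from
`hS1 h37 hPT hF1 hKo hnf` (`JetchevIrreducibleSwapAtP.cor15_irreducibleReadingTwoSplit_of_namedFacts`). Displayed: named facts by name, Cremona's `N`, `r_an = 0`,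
the lattice-optimal datum with `3 ∤ c(D)`, the field, the twist numerics. Per pair; nothing booked; BSD is not proved by this.
[cite: MatarNekovar2019, Thm. 0.7 (p. 456), §0.11 (p. 457)] [cite: GrossLMS1991, Prop. 3.7 (2)] [cite: GrossZagier1986, III (3.1)]
[cite: MilneADT2006, I Thm. 4.10] [cite: Jetchev2008, Cor. 1.5] [cite: Miller2011LMS, Def. 1.1] [cite: Cremona2006, Table 1 (Cremona label 412992bx1)] -/
theorem missingUpperBoundAt_g412992bx1_3_nf
    (hGZ : ∀ (N : ℕ) [NeZero N] (W : WeierstrassCurve ℚ) (K : Type) [Field K] [NumberField K],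
      gross_zagier N W K)
    (hKo : ∀ (N : ℕ) [NeZero N] (W : WeierstrassCurve ℚ) (K : Type) [Field K] [NumberField K],
      kolyvagin N W K)
    (hMN : ∀ (N : ℕ) [NeZero N] (W : WeierstrassCurve ℚ) (K : Type) [Field K] [NumberField K],
      MatarNekovar2019.thm03_padicValNat_card_sha_le_of_irreducible N W K)
    (hGZK : rank_eq_analyticRank_of_analyticRank_le_one) (hmod : hasEntireLFunction_rat)
    (hS1 : MatarNekovar2019.thm07_padicValNat_card_sha_primary_add_le_of_globalDivisibility_of_irreducible)
    (h37 : GrossLMS1991.prop37_2_frobeniusCongruence)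
    (hPT : ∀ (K : Type) [Field K] [NumberField K], poitouTate_selmerStructure_duality_conj K)
    (hF1 : Gross1991_heegnerPoint_sub_ratTorsion_mem_E0_imageFree) (hnf : exists_isNewformOf)
    {W : WeierstrassCurve ℚ} [W.IsElliptic] [W.IsGloballyMinimal] (hWeq : W = (⟨0, 0, 0, (-43798121268), 3528022418672640⟩ : WeierstrassCurve ℚ))
    (hN : W.conductorNorm ℤ = 412992) (hr : W.analyticRank = 0)
    (D : ModularParametrizationData W 412992) (hopt : ∀ z ∈ D.L.lattice, ∃ w ∈ periodLattice D.f, z = (D.c : ℂ) * w)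
    (hc : ¬ (3 : ℤ) ∣ D.c)
    (K : Type) [Field K] [NumberField K] (hK : IsImaginaryQuadratic K) (hdK : NumberField.discr K = -2807)
    {Wd : WeierstrassCurve ℚ} [Wd.IsElliptic] [Wd.IsGloballyMinimal] (hWdeq : Wd = (⟨0, 0, 0, (-345096303202767732), (-78029455089851271992939520)⟩ : WeierstrassCurve ℚ))
    (hrd : Wd.analyticRank = 1) {qd : ℚ} (hqd : shaAn Wd = (qd : ℂ)) (hvd : padicValRat 3 qd ≤ 0) :
    MissingUpperBoundAt W 3 :=
  missingUpperBoundAt_g412992bx1_3_img hGZ hKo hMN hGZK hmod (JetchevIrreducibleSwapAtP.cor15_irreducibleReadingTwoSplit_of_namedFacts hS1 h37 hPT hF1 hKo hnf) hWeq hN hr D hopt hc K hK hdK hWdeq hrd hqd hvd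

/-- **RECORD `447174gp1` @ `3`, NAMED-FACTS FORM** — `missingUpperBoundAt_g447174gp1_3_img` with the schema `hJ2` DERIVED from
`hS1 h37 hPT hF1 hKo hnf` (`JetchevIrreducibleSwapAtP.cor15_irreducibleReadingTwoSplit_of_namedFacts`). Displayed: named facts by name, Cremona's `N`, `r_an = 0`,
the lattice-optimal datum with `3 ∤ c(D)`, the field, the twist numerics. Per pair; nothing booked; BSD is not proved by this.
[cite: MatarNekovar2019, Thm. 0.7 (p. 456), §0.11 (p. 457)] [cite: GrossLMS1991, Prop. 3.7 (2)] [cite: GrossZagier1986, III (3.1)]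
[cite: MilneADT2006, I Thm. 4.10] [cite: Jetchev2008, Cor. 1.5] [cite: Miller2011LMS, Def. 1.1] [cite: Cremona2006, Table 1 (Cremona label 447174gp1)] -/
theorem missingUpperBoundAt_g447174gp1_3_nf
    (hGZ : ∀ (N : ℕ) [NeZero N] (W : WeierstrassCurve ℚ) (K : Type) [Field K] [NumberField K],
      gross_zagier N W K)
    (hKo : ∀ (N : ℕ) [NeZero N] (W : WeierstrassCurve ℚ) (K : Type) [Field K] [NumberField K],
      kolyvagin N W K)
    (hMN : ∀ (N : ℕ) [NeZero N] (W : WeierstrassCurve ℚ) (K : Type) [Field K] [NumberField K],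
      MatarNekovar2019.thm03_padicValNat_card_sha_le_of_irreducible N W K)
    (hGZK : rank_eq_analyticRank_of_analyticRank_le_one) (hmod : hasEntireLFunction_rat)
    (hS1 : MatarNekovar2019.thm07_padicValNat_card_sha_primary_add_le_of_globalDivisibility_of_irreducible)
    (h37 : GrossLMS1991.prop37_2_frobeniusCongruence)
    (hPT : ∀ (K : Type) [Field K] [NumberField K], poitouTate_selmerStructure_duality_conj K)
    (hF1 : Gross1991_heegnerPoint_sub_ratTorsion_mem_E0_imageFree) (hnf : exists_isNewformOf)
    {W : WeierstrassCurve ℚ} [W.IsElliptic] [W.IsGloballyMinimal] (hWeq : W = (⟨1, (-1), 1, (-13988162), 15799310713⟩ : WeierstrassCurve ℚ))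
    (hN : W.conductorNorm ℤ = 447174) (hr : W.analyticRank = 0)
    (D : ModularParametrizationData W 447174) (hopt : ∀ z ∈ D.L.lattice, ∃ w ∈ periodLattice D.f, z = (D.c : ℂ) * w)
    (hc : ¬ (3 : ℤ) ∣ D.c)
    (K : Type) [Field K] [NumberField K] (hK : IsImaginaryQuadratic K) (hdK : NumberField.discr K = -4343)
    {Wd : WeierstrassCurve ℚ} [Wd.IsElliptic] [Wd.IsGloballyMinimal] (hWdeq : Wd = (⟨1, (-1), 1, (-263839795904873), (-1293932043662506419167)⟩ : WeierstrassCurve ℚ))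
    (hrd : Wd.analyticRank = 1) {qd : ℚ} (hqd : shaAn Wd = (qd : ℂ)) (hvd : padicValRat 3 qd ≤ 0) :
    MissingUpperBoundAt W 3 :=
  missingUpperBoundAt_g447174gp1_3_img hGZ hKo hMN hGZK hmod (JetchevIrreducibleSwapAtP.cor15_irreducibleReadingTwoSplit_of_namedFacts hS1 h37 hPT hF1 hKo hnf) hWeq hN hr D hopt hc K hK hdK hWdeq hrd hqd hvd

end Summit.BirchSwinnertonDyer.BirchSwinnertonDyer.Theorems.WildUpperUnitTwistRecords

end
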